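import Literature.NumberTheory.Rogawski1990.ArchTransfFamilyJumpHead      -- PART 3f (LH7-p02 (g2)): `archBzJump_transfFam_of_hc`; brings ★ (SB-TRANSF) `archBzSmoothBounded_transfFam_of_hc`
import Literature.NumberTheory.Rogawski1990.ArchTransfFamilyBouaziz       -- ★ (L2-ASSEMBLY, LH3-p02 (g2)): `archBouazizSpaceH_transfFam_of_hc`
import HarnessLib

/-!
# Organ O-L2 «Transf» CLOSED: `transfFam L α μ F` lies in Bouaziz's space `ArchBouazizSpaceH jcH` for every `F ∈ ArchHCSpaceG (slotSign L α) jc′` with agreeing constants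
# (Bouaziz 1994 Rem. 2 p. 594, §3.2; Shelstad 1979 Thm. 4.7; Rogawski 1990 §4.3 (4.3.1))

Topic `NumberTheory/Rogawski1990`; namespace `Literature.NumberTheory.Rogawski1990`.  THEOREMS ONLY.  Cell `pub/hodgecm-mathlib`, line LH3 (closer stub `stub_N9`, crux H413 =
`stmt-HodgeConjecture-24833`), organ **O-L2** = ★ (L2-ASSEMBLY) `archBouazizSpaceH_transfFam_of_hc` (LH3-p02 (g2)) ∘ ★ (SB-TRANSF) `archBzSmoothBounded_transfFam_of_hc` (LH3-p04 (g3))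
∘ ★ (I₃-TRANSF) `archBzJump_transfFam_of_hc` (LH7-p02 (g2)): the three-line composition, binder-free but for the house-frame guards `hα`, `hreal`, the `μ`-guard `hμω`, HC's
space membership `hF` and the junction `hagree` of ★ `AgreesOnAdmissibleCoveredSlots` — the shape the LH3 skeleton's `stub_N9transf` consumes.  HONEST LABEL: HC_CM is proved only
modulo the 7 printed citations (2 remaining: hLiu418 = `stmt-HodgeConjecture-24832`, h413 = `stmt-HodgeConjecture-24833`) until rung 0 closes; count-neutral.

## References
* [Bouaziz1994IntegralesOrbitales] A. Bouaziz, *Intégrales orbitales sur les groupes de Lie réductifs*, Ann. Sci. ÉNS 27 (1994), §3.2 pp. 579–580, §6.2 p. 591, Rem. 2 p. 594.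
* [Shelstad1979] D. Shelstad, *Characters and inner forms of a quasi-split group over ℝ*, Compositio Math. 39 (1979), Thm. 4.7 p. 31.
* [Rogawski1990] J. D. Rogawski, *Automorphic Representations of Unitary Groups in Three Variables* (1990), §4.3 (4.3.1) p. 43.
-/

set_option autoImplicit false

noncomputable section

open NumberField NumberField.InfinitePlace Complex
open scoped Classical
open Literature.NumberTheory.Automorphic Literature.NumberTheory.Automorphic.UnitaryGroup Literature.NumberTheory.Automorphic.ArchCartan
open Literature.NumberTheory.GaloisRepresentations

namespace Literature.NumberTheory.Rogawski1990

variable (L : Type) [Field L] [NumberField L] [IsCMField L] (α : Fin 3 → L) (μ : HeckeCharacter L)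

/-- **ORGAN O-L2 «Transf» — `transfFam L α μ F ∈ ArchBouazizSpaceH jcH`.**  For the house frame (`α_i ≠ 0`, real at every place), the `μ`-guard `hμω`, a `G′`-side family
`F ∈ ArchHCSpaceG (slotSign L α) jc′` (Harish-Chandra's space) and `H`-side constants agreeing with `2·jc′ · 0 2` at the admissible covered walls, the candidate transfer family
satisfies ALL of Bouaziz's clauses (P), (W), (I₁)+(I₂), (I₃), (I₄) on `H_∞` — the three-line composition of ★ (L2-ASSEMBLY), ★ (SB-TRANSF) and ★ (I₃-TRANSF).
[cite: Bouaziz1994IntegralesOrbitales, Rem. 2 p. 594; §3.2 p. 580] [cite: Shelstad1979, Thm. 4.7 p. 31] [cite: Rogawski1990, §4.3 (4.3.1) p. 43] -/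
theorem archBouazizSpaceH_transfFam_of_hc_of_agrees (hα : ∀ i, α i ≠ 0)
    (hreal : ∀ (w : {w : InfinitePlace L // IsComplex w}) (i : Fin 3), (w.1.embedding (α i)).im = 0)
    (hμω : ∀ x : ideleGroup ↥(maximalRealSubfield L), μ (AdeleRing.ideleBaseChange (↥(maximalRealSubfield L)) L x) = quadraticHeckeCharCM L x)
    {jc' : Finset {w : InfinitePlace L // IsComplex w} → {w : InfinitePlace L // IsComplex w} → Fin 3 → Fin 3 → ℂ}
    {jcH : Finset {w : InfinitePlace L // IsComplex w} → {w : InfinitePlace L // IsComplex w} → ℂ}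
    {F : Finset {w : InfinitePlace L // IsComplex w} → ({w : InfinitePlace L // IsComplex w} → Fin 3 → ℝ) → ℂ} (hF : ArchHCSpaceG (slotSign L α) jc' F)
    (hagree : AgreesOnAdmissibleCoveredSlots L α jc' jcH) :
    ArchBouazizSpaceH jcH (transfFam L α μ F) :=
  archBouazizSpaceH_transfFam_of_hc L α μ F hF (archBzSmoothBounded_transfFam_of_hc L α μ hα hreal hμω hF) (archBzJump_transfFam_of_hc L α μ hα hreal hμω hF hagree)

end Literature.NumberTheory.Rogawski1990

end
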